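import Summits.Ventures.CertifiedQuantumChemistry.Rows.SectorRows
import Literature.MathematicalPhysics.QuantumChemistry.TempleThirringBoundsProofs
import Literature.MathematicalPhysics.QuantumChemistry.SectorRayleighRitz
import Literature.MathematicalPhysics.QuantumLattice.SectorEigenvalueContinuation
import Literature.MathematicalPhysics.QuantumLattice.HubbardSzSectorLadder
import HarnessLib

/-!
# Ventures/CertifiedQuantumChemistry — Rows/TempleLowerRow.lean: SOUNDNESS of the variance / Temple
# LOWER certificate (door M1/U5 of the I-DIFF census): an explicit sector state with its first two
# exact moments plus a certified SECTOR-GAP bound `β ≤ E₁` proves a `LowerRow` — no relaxation, no SDP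

HONEST FRAMING (verbatim): certified bounds for a stated model Hamiltonian in a stated basis; not a
claim about the real molecule or material beyond that model.

Seat chem-solver-6 (LADDER-CHEM I-DIFF, cell chem-oracle; chem-lead 18:57:18Z (B) «door M1/U5»,
director-chem 19:38:25Z pointer to chem-idea-1; solver/diff-lambda/DESIGN.md §3–§5). Statements over the
venture's vocabulary (`Model`, `Model.energy`, `LowerRow`, `IsInSector`) and the Literature facts
`templeInequality` / `templeInequality_holds` (Reed–Simon IV Thm XIII.5 — typed by chem-type-09, PROVED in
`TempleThirringBoundsProofs`); nothing is restated, nothing is asserted about any file.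

## The certificate and why it is sound
Temple's inequality in the `(a, b)` sector `K`: for a unit `ψ ∈ K` with `(ψ, Hψ) < β` and `β` below every
eigenvalue of `H|_K` other than `E₀ = E₀(H; a, b)`,
`E₀ ≥ (ψ, Hψ) − ((ψ, H²ψ) − (ψ, Hψ)²)/(β − (ψ, Hψ))`. In HOMOGENEOUS form (what an integer-CI / dyadic
producer evaluates exactly, no square roots): for ANY nonzero sector vector `ψ` with
`A := Re(ψ, Hψ)`, `B := Re(ψ, H²ψ)`, `n := Re(ψ, ψ)` and `A < β·n`,
`E₀ ≥ (β·A − B)/(β·n − A)` («Temple quotient»), i.e. every rational `lo` with `lo·(β·n − A) ≤ β·A − B`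
is a certified lower row. The width of the resulting bracket `[lo, A/n]` is `(B/n − (A/n)²)/(β − A/n)`
= variance / (gap margin): second order in the residual, and it uses NO N-representability relaxation.

* `GapCertificate F a b β` — the ONE conditional leg (named, not asserted): every eigenvalue of `H_F` with
  an eigenvector in the `(a, b)` sector, other than the sector ground energy, is `≥ β`. WHAT SUPPLIES IT:
  at FCI scale, `gapCertificate_of_rankOne_shift` below (Courant–Fischer: the quadratic form of
  `H − β + c·φφ†` nonnegative on the sector, for ANY explicit `φ` and real `c` — the same PSD object as
  pub-qchem's `qc-lower-chol-v0` certificates, `Rows/CholeskyResidualBound.lean`, on a rank-one update of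
  the ground symmetry block); at SDP scale NO supplier is known (solver/diff-lambda/DESIGN.md §4 lists
  the non-suppliers with reasons). A row built on an undischarged `GapCertificate` is CONDITIONAL and is
  tabled as such.
* `TempleCertificate F a b lo β` — the producer's object: an explicit nonzero `ψ` supported on the sector,
  with the two exact moments satisfying `A < β·n` and `lo·(β·n − A) ≤ β·A − B`.
* `lowerRow_of_temple` — `GapCertificate F a b β → TempleCertificate F a b lo β → LowerRow F a b lo`
  for a symmetric model. With the qcu0 upper `UpperCertificate F a b (A/n)` of the same `ψ`
  (`Rows/SectorRows.upperRow_of_certificate`) this is a `Bracket`; DIFFERENCE rows between two files then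
  follow from `Rows/DifferenceRows.diffBracket_of_brackets` with NO further lemma (the «variance/Temple
  difference form» of the census is this composition; DESIGN.md §3 shows it is dominated by the two
  absolute Temple brackets whenever `β` exists).
* `secondMoment_eq_normSq_mulVec` — for the producer/reader: `Re(ψ, H²ψ) = Re(Hψ, Hψ) = ‖Hψ‖²`, so `B` is
  ONE exact sparse mat-vec beyond today's qcu0 evaluation.
* `gapCertificate_of_rankOne_shift` — the FCI-scale supplier of the conditional leg.

What is NOT here: any certificate instance, number or claim node; Kato's two-sided refinement; an SDP-scale
supplier of `GapCertificate` (open; chem-idea-1's door M1).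

References: M. Reed, B. Simon, *Methods of Modern Mathematical Physics IV* (1978), Thm XIII.5 p. 84
[cite: ReedSimonIV1978, Thm XIII.5]; R. A. Horn, C. R. Johnson, *Matrix Analysis* 2nd ed. (2013),
Thm 4.2.6 (Courant–Fischer) [cite: HornJohnson2013, Thm 4.2.6].
-/

noncomputable section

namespace Summit.Ventures.CertifiedQuantumChemistry

open Matrix Finset
open Literature.MathematicalPhysics.QuantumLattice Literature.MathematicalPhysics.QuantumChemistry
open Literature.MathematicalPhysics.QuantumLattice.EigenvalueContinuation
open scoped ComplexOrder ComplexConjugate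

variable {k : ℕ}

/-! ## §1 The two predicates -/

/-- **Certified sector-gap leg** (the hypothesis of Temple's inequality, named): every eigenvalue `e` of
`H_F` that has a NONZERO eigenvector supported on the `(a, b)` sector and differs from the sector ground
energy `E₀(H_F; a, b)` satisfies `β ≤ e` — i.e. `β ≤ E₁(H_F; a, b)`, the second sector eigenvalue.
Nothing is asserted; a row citing an undischarged `GapCertificate` is conditional on it.
[cite: ReedSimonIV1978, Thm XIII.5] -/
def GapCertificate (F : Model k) (a b : ℕ) (β : ℚ) : Prop :=
  ∀ (e : ℝ) (v : Fock (Orb (Fin k))), IsInSector a b v → v ≠ 0 →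
    F.hamiltonian *ᵥ v = (e : ℂ) • v → e ≠ F.energy a b → ((β : ℚ) : ℝ) ≤ e

/-- **Temple (variance) LOWER certificate predicate**, homogeneous exact form: an explicit NONZERO vector
`ψ` supported on the `(a, b)` determinant sector whose exact moments `A = Re(ψ, H_Fψ)`,
`B = Re(ψ, H_F²ψ)`, `n = Re(ψ, ψ)` satisfy `A < β·n` (the trial energy lies below the gap bound) and
`lo·(β·n − A) ≤ β·A − B` (the rational slot `lo` is at most Temple's quotient `(βA − B)/(βn − A)`).
Integer CI vector: all four numbers exact rationals; dyadic MPS: outward-rounded interval ends.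
[cite: ReedSimonIV1978, Thm XIII.5] -/
def TempleCertificate (F : Model k) (a b : ℕ) (lo β : ℚ) : Prop :=
  ∃ ψ : Fock (Orb (Fin k)), IsInSector a b ψ ∧ ψ ≠ 0 ∧
    (star ψ ⬝ᵥ F.hamiltonian *ᵥ ψ).re < ((β : ℚ) : ℝ) * (star ψ ⬝ᵥ ψ).re ∧
    ((lo : ℚ) : ℝ) * (((β : ℚ) : ℝ) * (star ψ ⬝ᵥ ψ).re - (star ψ ⬝ᵥ F.hamiltonian *ᵥ ψ).re) ≤
      ((β : ℚ) : ℝ) * (star ψ ⬝ᵥ F.hamiltonian *ᵥ ψ).re -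
        (star ψ ⬝ᵥ (F.hamiltonian * F.hamiltonian) *ᵥ ψ).re

/-! ## §2 Helper identities -/

/-- Scaling a vector by a real `c` scales every Hermitian-form value by `c²`:
`Re(cψ, M(cψ)) = c·c·Re(ψ, Mψ)`. [folklore] -/
theorem re_star_smul_dotProduct_mulVec_smul {ι : Type*} [Fintype ι] (M : Matrix ι ι ℂ)
    (c : ℝ) (ψ : ι → ℂ) :
    (star ((c : ℂ) • ψ) ⬝ᵥ M *ᵥ ((c : ℂ) • ψ)).re = c * c * (star ψ ⬝ᵥ M *ᵥ ψ).re := by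
  rw [mulVec_smul, star_smul, smul_dotProduct, dotProduct_smul, smul_eq_mul, smul_eq_mul,
    Complex.star_def, Complex.conj_ofReal, ← mul_assoc, ← Complex.ofReal_mul, Complex.re_ofReal_mul]

/-- **The second moment is the squared norm of one mat-vec** (what the producer evaluates): for Hermitian
`H`, `(ψ, H²ψ) = (Hψ, Hψ)`. [folklore] -/
theorem secondMoment_eq_normSq_mulVec {ι : Type*} [Fintype ι] {H : Matrix ι ι ℂ} (hH : H.IsHermitian)
    (ψ : ι → ℂ) : star ψ ⬝ᵥ (H * H) *ᵥ ψ = star (H *ᵥ ψ) ⬝ᵥ (H *ᵥ ψ) := by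
  rw [← mulVec_mulVec, dotProduct_mulVec, star_mulVec, hH.eq]

/-! ## §3 Soundness: Temple certificate + gap leg ⇒ lower row -/

/-- **SOUNDNESS OF THE TEMPLE LOWER CERTIFICATE.** For a symmetric model `F`, a certified sector-gap
leg `GapCertificate F a b β` and a Temple certificate `TempleCertificate F a b lo β` give the lower row
`lo ≤ E₀(H_F; a, b)` (with its range `a, b ≤ k` supplied by the witness). Proof: normalise the witness,
apply `templeInequality_holds` in the sector `K = szSector (a + b) ((a − b)/2)` (which `H_F` preserves),
and clear denominators. [cite: ReedSimonIV1978, Thm XIII.5] -/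
theorem lowerRow_of_temple {F : Model k} (hF : F.IsSymmetric) {a b : ℕ} {lo β : ℚ}
    (hG : GapCertificate F a b β) (hT : TempleCertificate F a b lo β) : LowerRow F a b lo := by
  obtain ⟨ψ, hψ, hψ0, hlt, hle⟩ := hT
  have hH : F.hamiltonian.IsHermitian := Model.hamiltonian_isHermitian hF
  obtain ⟨ha, hb⟩ := range_of_isInSector_ne_zero hψ hψ0
  refine ⟨ha, hb, ?_⟩
  -- the sector as a submodule, invariant under `H_F`
  set K : Submodule ℂ (Fock (Orb (Fin k))) := szSector (a + b) (((a : ℝ) - b) / 2) with hKdef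
  have hψK : ψ ∈ K := (mem_szSector_iff_isInSector a b ψ).2 hψ
  have hKH : ∀ v ∈ K, F.hamiltonian *ᵥ v ∈ K := fun v hv =>
    molecularHamiltonian_mulVec_mem_szSector _ _ _ hv
  have hE : F.energy a b = F.hamiltonian.minEnergyOn K := rfl
  -- the gap hypothesis in Temple's form
  have hgap : ∀ (e : ℝ) (v : Fock (Orb (Fin k))), v ∈ K → v ≠ 0 →
      F.hamiltonian *ᵥ v = (e : ℂ) • v → e ≠ F.hamiltonian.minEnergyOn K → ((β : ℚ) : ℝ) ≤ e :=
    fun e v hv hv0 hHv hne => hG e v ((mem_szSector_iff_isInSector a b v).1 hv) hv0 hHv (hE ▸ hne)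
  -- normalise the witness
  obtain ⟨c, hc, hcc, h1⟩ := exists_normalize hψ0
  have hψ'K : ((c : ℂ) • ψ) ∈ K := K.smul_mem _ hψK
  -- abbreviations for the exact moments
  set A : ℝ := (star ψ ⬝ᵥ F.hamiltonian *ᵥ ψ).re with hAdef
  set B : ℝ := (star ψ ⬝ᵥ (F.hamiltonian * F.hamiltonian) *ᵥ ψ).re with hBdef
  set nn : ℝ := (star ψ ⬝ᵥ ψ).re with hndef
  set β' : ℝ := ((β : ℚ) : ℝ) with hβ'def
  have hct : 0 < c * c := mul_pos hc hc
  have hρ' : (star ((c : ℂ) • ψ) ⬝ᵥ F.hamiltonian *ᵥ ((c : ℂ) • ψ)).re = c * c * A :=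
    re_star_smul_dotProduct_mulVec_smul _ c ψ
  have hm' : (star ((c : ℂ) • ψ) ⬝ᵥ (F.hamiltonian * F.hamiltonian) *ᵥ ((c : ℂ) • ψ)).re =
      c * c * B :=
    re_star_smul_dotProduct_mulVec_smul _ c ψ
  -- the normalised trial energy lies below `β`
  have hlt' : c * c * A < β' := by
    have h := mul_lt_mul_of_pos_left hlt hct
    calc c * c * A < c * c * (β' * nn) := h
      _ = β' * (c * c * nn) := by ring
      _ = β' := by rw [hcc, mul_one]
  -- Temple's inequality for the unit vector `c • ψ`
  have hT := templeInequality_holds F.hamiltonian hH K hKH β' hgap ((c : ℂ) • ψ) hψ'K h1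
    (by rw [hρ']; exact hlt')
  rw [hρ', hm'] at hT
  rw [hE]
  refine le_trans ?_ hT
  -- clear denominators: `lo ≤ (β ρ' − m')/(β − ρ')` with `ρ' = c²A`, `m' = c²B`, `c²n = 1`
  have hpos : 0 < β' - c * c * A := sub_pos.2 hlt'
  have hne0 : β' - c * c * A ≠ 0 := hpos.ne'
  have hX : c * c * A - (c * c * B - (c * c * A) ^ 2) / (β' - c * c * A) =
      (β' * (c * c * A) - c * c * B) / (β' - c * c * A) := by
    rw [eq_div_iff hne0, sub_mul, div_mul_cancel₀ _ hne0]
    ring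
  rw [hX, le_div_iff₀ hpos]
  have h2 := mul_le_mul_of_nonneg_left hle hct.le
  -- `c²·[lo(βn − A)] ≤ c²·[βA − B]` and `c² n = 1`
  have h3 : ((lo : ℚ) : ℝ) * (β' - c * c * A) = c * c * (((lo : ℚ) : ℝ) * (β' * nn - A)) := by
    have : β' = β' * (c * c * nn) := by rw [hcc, mul_one]
    conv_lhs => rw [this]
    ring
  rw [h3]
  refine h2.trans (le_of_eq ?_)
  ring

/-- **The Temple certificate also carries its own UPPER row** (Rayleigh–Ritz with the same witness): if
`A ≤ hi·n` for the witness's exact moments then `UpperRow F a b hi` — recorded so a Temple producer files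
BOTH sides from one state (`Rows/SectorRows.upperRow_of_certificate`). [cite: ReedSimonIV1978, Thm XIII.5] -/
theorem upperRow_of_temple_witness {F : Model k} (hF : F.IsSymmetric) {a b : ℕ} {hi : ℚ}
    {ψ : Fock (Orb (Fin k))} (hψ : IsInSector a b ψ) (hψ0 : ψ ≠ 0)
    (hu : (star ψ ⬝ᵥ F.hamiltonian *ᵥ ψ).re ≤ ((hi : ℚ) : ℝ) * (star ψ ⬝ᵥ ψ).re) :
    UpperRow F a b hi :=
  upperRow_of_certificate hF ⟨ψ, hψ, hψ0, hu⟩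

/-! ## §4 The FCI-scale supplier of the gap leg: Courant–Fischer with a rank-one shift -/

/-- **Gap leg from a rank-one-shifted PSD certificate** (Courant–Fischer, Horn–Johnson Thm 4.2.6): if for
some explicit vector `φ` and real `c` (a producer takes `c ≥ 0`; the sign is not needed) the quadratic
form of `H_F − β + c·φφ†` is nonnegative on the `(a, b)` sector — `β·(v, v) ≤ Re(v, H_F v) + c·|(φ, v)|²`
for every sector vector `v` — then every sector eigenvalue other than the ground energy is `≥ β`, i.e.
`GapCertificate F a b β`. (On `φ^⊥` the shift vanishes, and `φ^⊥` meets the span of a ground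
eigenvector and any other eigenvector.) The hypothesis is exactly a `qc-lower-chol-v0`-type PSD
certificate (`Rows/CholeskyResidualBound.lean`) for the shifted, rank-one-updated sector matrix; `φ` =
the producer's float ground vector rounded to integers.
[cite: HornJohnson2013, Thm 4.2.6] -/
theorem gapCertificate_of_rankOne_shift {F : Model k} (hF : F.IsSymmetric) {a b : ℕ} {β : ℚ}
    (φ : Fock (Orb (Fin k))) (c : ℝ)
    (hpsd : ∀ v : Fock (Orb (Fin k)), IsInSector a b v →
      ((β : ℚ) : ℝ) * (star v ⬝ᵥ v).re ≤
        (star v ⬝ᵥ F.hamiltonian *ᵥ v).re + c * ‖star φ ⬝ᵥ v‖ ^ 2) :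
    GapCertificate F a b β := by
  intro e v hv hv0 hHv hne
  have hH : F.hamiltonian.IsHermitian := Model.hamiltonian_isHermitian hF
  set K : Submodule ℂ (Fock (Orb (Fin k))) := szSector (a + b) (((a : ℝ) - b) / 2) with hKdef
  have hvK : v ∈ K := (mem_szSector_iff_isInSector a b v).2 hv
  have hKH : ∀ w ∈ K, F.hamiltonian *ᵥ w ∈ K := fun w hw =>
    molecularHamiltonian_mulVec_mem_szSector _ _ _ hw
  have hK : K ≠ ⊥ := by
    rw [Submodule.ne_bot_iff]
    exact ⟨v, hvK, hv0⟩
  have hE : F.energy a b = F.hamiltonian.minEnergyOn K := rfl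
  set E₀ : ℝ := F.hamiltonian.minEnergyOn K with hE₀def
  set β' : ℝ := ((β : ℚ) : ℝ) with hβ'def
  -- a unit ground eigenvector `u` in the sector, orthogonal to `v`
  obtain ⟨u, huK, hu1, hHu⟩ := exists_unit_eigen_minEnergyOn hH K hKH hK
  have hu : IsInSector a b u := (mem_szSector_iff_isInSector a b u).1 huK
  have hE0e : E₀ ≤ e := minEnergyOn_le_of_eigenvector hH K hvK hv0 hHv
  have hne' : E₀ ≠ e := fun h => hne (hE.trans h).symm
  have horth : star u ⬝ᵥ v = 0 := star_dotProduct_eq_zero_of_eigen hH.eq hne' hHu hHv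
  have horth' : star v ⬝ᵥ u = 0 := by rw [star_dotProduct, horth, star_zero]
  have hnv : 0 < (star v ⬝ᵥ v).re := re_star_dotProduct_self_pos hv0
  -- Rayleigh values of the eigenvectors
  have hvHv : (star v ⬝ᵥ F.hamiltonian *ᵥ v).re = e * (star v ⬝ᵥ v).re := by
    rw [hHv, dotProduct_smul, smul_eq_mul, Complex.re_ofReal_mul]
  by_cases hφv : star φ ⬝ᵥ v = 0
  · -- `v ⊥ φ`: the PSD hypothesis at `v` reads `β‖v‖² ≤ e‖v‖²`
    have h := hpsd v hv
    rw [hφv, norm_zero, zero_pow two_ne_zero, mul_zero, add_zero, hvHv] at h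
    exact le_of_mul_le_mul_right h hnv
  · -- general case: `w = (φ,v)·u − (φ,u)·v` is a nonzero sector vector orthogonal to `φ`
    set α : ℂ := star φ ⬝ᵥ v with hαdef
    set γ : ℂ := star φ ⬝ᵥ u with hγdef
    set w : Fock (Orb (Fin k)) := α • u - γ • v with hwdef
    have hwK : w ∈ K := K.sub_mem (K.smul_mem _ huK) (K.smul_mem _ hvK)
    have hw : IsInSector a b w := (mem_szSector_iff_isInSector a b w).1 hwK
    have hφw : star φ ⬝ᵥ w = 0 := by
      rw [hwdef, dotProduct_sub, dotProduct_smul, dotProduct_smul, smul_eq_mul, smul_eq_mul, ← hαdef,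
        ← hγdef, mul_comm, sub_self]
    -- norms and forms of `w` (the cross terms vanish by `u ⊥ v`)
    have hww : star w ⬝ᵥ w = star α * α + star γ * γ * (star v ⬝ᵥ v) := by
      rw [hwdef, star_sub, star_smul, star_smul, sub_dotProduct, dotProduct_sub, dotProduct_sub,
        smul_dotProduct, smul_dotProduct, smul_dotProduct, smul_dotProduct, dotProduct_smul,
        dotProduct_smul, dotProduct_smul, dotProduct_smul, hu1, horth, horth']
      simp only [smul_eq_mul, mul_one, mul_zero, sub_zero, zero_sub]
      ring
    have hwHw : star w ⬝ᵥ F.hamiltonian *ᵥ w =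
        star α * α * (E₀ : ℂ) + star γ * γ * (e : ℂ) * (star v ⬝ᵥ v) := by
      rw [hwdef, mulVec_sub, mulVec_smul, mulVec_smul, hHu, hHv, star_sub, star_smul, star_smul,
        sub_dotProduct, dotProduct_sub, dotProduct_sub, smul_dotProduct, smul_dotProduct,
        smul_dotProduct, smul_dotProduct, dotProduct_smul, dotProduct_smul, dotProduct_smul,
        dotProduct_smul, dotProduct_smul, dotProduct_smul, dotProduct_smul, dotProduct_smul, hu1, horth,
        horth']
      simp only [smul_eq_mul, mul_one, mul_zero, sub_zero, zero_sub]
      ring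
    have hαα : (star α * α) = ((‖α‖ ^ 2 : ℝ) : ℂ) := by
      rw [Complex.star_def, Complex.conj_mul', Complex.ofReal_pow]
    have hγγ : (star γ * γ) = ((‖γ‖ ^ 2 : ℝ) : ℂ) := by
      rw [Complex.star_def, Complex.conj_mul', Complex.ofReal_pow]
    set nv : ℝ := (star v ⬝ᵥ v).re with hnvdef
    have hvv : star v ⬝ᵥ v = ((nv : ℝ) : ℂ) :=
      Complex.ext (by simp [hnvdef]) (by simp [im_star_dotProduct_self])
    have hww_re : (star w ⬝ᵥ w).re = ‖α‖ ^ 2 + ‖γ‖ ^ 2 * nv := by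
      rw [hww, hαα, hγγ, hvv]
      simp only [← Complex.ofReal_mul, ← Complex.ofReal_add, Complex.ofReal_re]
    have hwHw_re : (star w ⬝ᵥ F.hamiltonian *ᵥ w).re = ‖α‖ ^ 2 * E₀ + ‖γ‖ ^ 2 * e * nv := by
      rw [hwHw, hαα, hγγ, hvv]
      simp only [← Complex.ofReal_mul, ← Complex.ofReal_add, Complex.ofReal_re]
    -- the PSD hypothesis at `w`
    have h := hpsd w hw
    rw [hφw, norm_zero, zero_pow two_ne_zero, mul_zero, add_zero, hww_re, hwHw_re] at h
    have hα0 : 0 < ‖α‖ ^ 2 := pow_pos (norm_pos_iff.2 hφv) 2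
    have hγn : 0 ≤ ‖γ‖ ^ 2 * nv := mul_nonneg (sq_nonneg _) hnv.le
    -- `β(|α|² + |γ|²n) ≤ E₀|α|² + e|γ|²n ≤ e(|α|² + |γ|²n)`
    have htot : 0 < ‖α‖ ^ 2 + ‖γ‖ ^ 2 * nv := by linarith
    have h' : β' * (‖α‖ ^ 2 + ‖γ‖ ^ 2 * nv) ≤ e * (‖α‖ ^ 2 + ‖γ‖ ^ 2 * nv) := by
      have hmono : ‖α‖ ^ 2 * E₀ ≤ ‖α‖ ^ 2 * e := mul_le_mul_of_nonneg_left hE0e hα0.le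
      nlinarith
    exact le_of_mul_le_mul_right h' htot

end Summit.Ventures.CertifiedQuantumChemistry

end
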